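import Literature.MathematicalPhysics.QuantumLattice.HubbardEffectiveActionCTSpinFlip
import Literature.MathematicalPhysics.QuantumLattice.GrassmannChargeScaling
import HarnessLib

/-!
# The spin-resolved charge symmetry `ψ̂^±_{k,σ} ↦ z_σ^{±1} ψ̂^±_{k,σ}` of the countertermed Hubbard effective action
# (no pair seed) and the selection rule: kernels conserve the charge OF EACH SPIN

Topic `MathematicalPhysics/QuantumLattice`; companion of `GrassmannChargeScaling.lean` (covariance of `effAction` and of the
kernels under a rescaling `ψ(X) ↦ c(X) ψ(X)` of the generators; the `U(1)` selection rule `kernel_eq_zero_of_invariant`) and of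
`HubbardEffectiveActionCTSymmetry.lean` / `HubbardEffectiveActionCTSpinFlip.lean` / `HubbardEffectiveActionCTTimeReversal.lean`
(the other symmetries of BGM 2006 §2.1 for the tree's `hubbardEffectiveActionCT`).  Benfatto–Giuliani–Mastropietro 2006 §2.1,
symmetry (2): "global `U(1)`: `ψ^±_{x,σ} → e^{±iα_σ} ψ^±_{x,σ}`" — a SPIN-DEPENDENT phase.  Here, for any nonvanishing weights
`z : Fin 2 → ℂ`, the scaling `c(((k, σ), +)) = z_σ`, `c(((k, σ), −)) = z_σ⁻¹` (written inline, no definition; `+ = 0`, `− = 1` is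
the tree's charge index):

* `map_spinCharge_psiPlus/psiMinus`, `map_spinCharge_hubbardInteraction`, `map_spinCharge_counterQuadratic`,
  **`map_spinCharge_hubbardInteractionCT`** — `V_K` is invariant (every monomial `ψ̂⁺_{k₁↑}ψ̂⁻_{k₂↑}ψ̂⁺_{k₃↓}ψ̂⁻_{k₄↓}`,
  `ψ̂⁺_{kσ}ψ̂⁻_{kσ}` has total weight `1`);
* **`spinCharge_mul_hubbardTwoPointCT`**, `…CovarianceCT`, `…CovAboveCT` — at seed `h = 0` the covariance pairs only `ψ̂⁺_{kσ}`
  with `ψ̂⁻_{kσ}` (same spin, opposite charge), so `c(X) c(Y) C^K_{>Λ}(X,Y) = C^K_{>Λ}(X,Y)`;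
* **`map_spinCharge_hubbardEffectiveActionCT`** — `S_c 𝒢^K_Λ = 𝒢^K_Λ` at `h = 0`;
  **`prod_spinCharge_mul_kernel_hubbardEffectiveActionCT`** — `(∏ᵢ c(Xᵢ)) · F_m(X) = F_m(X)`;
* **`kernel_hubbardEffectiveActionCT_eq_zero_of_spinCharge`** — the SELECTION RULE: `F_m(X_0,…,X_{m−1}) = 0` unless, for each
  spin `σ`, the numbers of `ψ̂⁺_{·,σ}` and `ψ̂⁻_{·,σ}` legs among the `Xᵢ` agree (BGM §2.3: only monomials with as many `ψ⁺_σ` as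
  `ψ⁻_σ` survive; e.g. the quartic kernel has only the six spin patterns `↑↑↑↑, ↓↓↓↓, ↑↑↓↓, ↓↓↑↑, ↑↓↓↑, ↓↑↑↓` on
  `ψ⁺ψ⁻ψ⁺ψ⁻`).

Everything is proved; no definitions.  Source: G. Benfatto, A. Giuliani, V. Mastropietro, Ann. Henri Poincaré 7 (2006) 809, §2.1
symmetry (2), §2.3 [`BenfattoGiulianiMastropietro2006`].
-/

noncomputable section

namespace Literature.MathematicalPhysics.QuantumLattice

open Literature.Probability.LatticeModels GrassmannAlgebra Finset

section Fields

variable (L M : ℕ) (z : Fin 2 → ℂ)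

/-- The scaling on `ψ̂⁺`: `ψ̂⁺_{k,σ} ↦ z_σ ψ̂⁺_{k,σ}`. [cite: BenfattoGiulianiMastropietro2006, §2.1 symmetry (2)] -/
theorem map_spinCharge_psiPlus (k : FreqMomentum L M) (s : Fin 2) : (ExteriorAlgebra.map (LinearMap.mulLeft ℂ (fun X : HubbardFieldIdx L M => if X.2 = 0 then z X.1.2 else (z X.1.2)⁻¹))) (psiPlus k s) = z s • psiPlus k s := by
  unfold psiPlus
  rw [map_mulLeft_gen]
  simp

/-- The scaling on `ψ̂⁻`: `ψ̂⁻_{k,σ} ↦ z_σ⁻¹ ψ̂⁻_{k,σ}`. [cite: BenfattoGiulianiMastropietro2006, §2.1 symmetry (2)] -/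
theorem map_spinCharge_psiMinus (k : FreqMomentum L M) (s : Fin 2) : (ExteriorAlgebra.map (LinearMap.mulLeft ℂ (fun X : HubbardFieldIdx L M => if X.2 = 0 then z X.1.2 else (z X.1.2)⁻¹))) (psiMinus k s) = (z s)⁻¹ • psiMinus k s := by
  unfold psiMinus
  rw [map_mulLeft_gen]
  simp

variable {z} (hz : ∀ s, z s ≠ 0)
include hz

/-- The scaling is by units: `c⁻¹ · c = 1` pointwise. [cite: BenfattoGiulianiMastropietro2006, §2.1 symmetry (2)] -/
theorem spinCharge_inv_mul : (fun X : HubbardFieldIdx L M => ((fun X : HubbardFieldIdx L M => if X.2 = 0 then z X.1.2 else (z X.1.2)⁻¹) X)⁻¹) * (fun X : HubbardFieldIdx L M => if X.2 = 0 then z X.1.2 else (z X.1.2)⁻¹) = 1 := by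
  funext X
  simp only [Pi.mul_apply, Pi.one_apply]
  split_ifs with h
  · exact inv_mul_cancel₀ (hz _)
  · exact inv_mul_cancel₀ (inv_ne_zero (hz _))

variable [NeZero L]

/-- **The Hubbard vertex is invariant under the spin-resolved charge scaling**: every monomial
`ψ̂⁺_{k₁↑}ψ̂⁻_{k₂↑}ψ̂⁺_{k₃↓}ψ̂⁻_{k₄↓}` picks up `z_↑ z_↑⁻¹ z_↓ z_↓⁻¹ = 1`. [cite: BenfattoGiulianiMastropietro2006, §2.1 symmetry (2)] -/
theorem map_spinCharge_hubbardInteraction (β U : ℝ) : (ExteriorAlgebra.map (LinearMap.mulLeft ℂ (fun X : HubbardFieldIdx L M => if X.2 = 0 then z X.1.2 else (z X.1.2)⁻¹))) (hubbardInteraction L M β U) = hubbardInteraction L M β U := by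
  rw [hubbardInteraction, map_smul]
  congr 1
  rw [map_sum]
  refine Finset.sum_congr rfl fun k₁ _ => ?_
  rw [map_sum]
  refine Finset.sum_congr rfl fun k₂ _ => ?_
  rw [map_sum]
  refine Finset.sum_congr rfl fun k₃ _ => ?_
  rw [map_sum]
  refine Finset.sum_congr rfl fun k₄ _ => ?_
  split_ifs
  · rw [map_mul, map_mul, map_mul, map_spinCharge_psiPlus, map_spinCharge_psiMinus, map_spinCharge_psiPlus,
      map_spinCharge_psiMinus]
    simp only [Algebra.smul_mul_assoc, Algebra.mul_smul_comm, smul_smul]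
    rw [show (z 1)⁻¹ * (z 1 * ((z 0)⁻¹ * z 0)) = 1 by
      rw [inv_mul_cancel₀ (hz 0), mul_one, inv_mul_cancel₀ (hz 1)], one_smul]
  · exact map_zero _

/-- **The counterterm vertex is invariant under the spin-resolved charge scaling** (`ψ̂⁺_{kσ}ψ̂⁻_{kσ}` has weight `1`).
[cite: BenfattoGiulianiMastropietro2006, §2.1 symmetry (2)] -/
theorem map_spinCharge_counterQuadratic (β : ℝ) (K : TrigPolyC4v) : (ExteriorAlgebra.map (LinearMap.mulLeft ℂ (fun X : HubbardFieldIdx L M => if X.2 = 0 then z X.1.2 else (z X.1.2)⁻¹))) (counterQuadratic L M β K) = counterQuadratic L M β K := by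
  rw [counterQuadratic, map_sum]
  refine Finset.sum_congr rfl fun k _ => ?_
  rw [map_sum]
  refine Finset.sum_congr rfl fun s _ => ?_
  rw [map_smul, map_mul, map_spinCharge_psiPlus, map_spinCharge_psiMinus]
  simp only [Algebra.smul_mul_assoc, Algebra.mul_smul_comm, smul_smul, inv_mul_cancel₀ (hz s), mul_one]

/-- **The interaction slot `V_K` is invariant under the spin-resolved charge scaling.** [cite: BenfattoGiulianiMastropietro2006, §2.1 symmetry (2)] -/
theorem map_spinCharge_hubbardInteractionCT (β U : ℝ) (K : TrigPolyC4v) :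
    (ExteriorAlgebra.map (LinearMap.mulLeft ℂ (fun X : HubbardFieldIdx L M => if X.2 = 0 then z X.1.2 else (z X.1.2)⁻¹))) (hubbardInteractionCT L M β U K) = hubbardInteractionCT L M β U K := by
  rw [hubbardInteractionCT, map_add, map_spinCharge_hubbardInteraction L M hz, map_spinCharge_counterQuadratic L M hz]

omit [NeZero L] in
/-- **The seedless CT two-point table carries total weight one**: `c(X) c(Y) ⟨ψ_X ψ_Y⟩₀^K = ⟨ψ_X ψ_Y⟩₀^K` at `h = 0` — the table pairs
only `ψ̂⁺_{kσ}` with `ψ̂⁻_{kσ}` (mixed-spin and equal-charge entries vanish without seed). [cite: BenfattoGiulianiMastropietro2006, §2.1 symmetry (2)] -/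
theorem spinCharge_mul_hubbardTwoPointCT (β μ : ℝ) (K : TrigPolyC4v) (X Y : HubbardFieldIdx L M) :
    (fun X : HubbardFieldIdx L M => if X.2 = 0 then z X.1.2 else (z X.1.2)⁻¹) X * (fun X : HubbardFieldIdx L M => if X.2 = 0 then z X.1.2 else (z X.1.2)⁻¹) Y * hubbardTwoPointCT L M β μ 0 K X Y = hubbardTwoPointCT L M β μ 0 K X Y := by
  obtain ⟨⟨k, s⟩, c⟩ := X
  obtain ⟨⟨k', s'⟩, c'⟩ := Y
  by_cases hk : k = k'
  · subst hk
    fin_cases s <;> fin_cases s' <;> fin_cases c <;> fin_cases c' <;>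
      simp [hubbardTwoPointCT, toNambu, nambuTwoPointCT, mul_inv_cancel₀ (hz _), inv_mul_cancel₀ (hz _)]
  · have hk' : ¬ k' = k := fun h => hk h.symm
    have hkn : ¬ k.neg = k'.neg := fun h => hk (by simpa using congrArg FreqMomentum.neg h)
    have hkn' : ¬ k'.neg = k.neg := fun h => hk' (by simpa using congrArg FreqMomentum.neg h)
    fin_cases s <;> fin_cases s' <;> fin_cases c <;> fin_cases c' <;>
      simp [hubbardTwoPointCT, toNambu, nambuTwoPointCT, hk, hk', hkn, hkn']

omit [NeZero L] in
/-- The seedless CT covariance carries total weight one: `c(X) c(Y) C^K(X,Y) = C^K(X,Y)`. [cite: BenfattoGiulianiMastropietro2006, §2.1 symmetry (2)] -/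
theorem spinCharge_mul_hubbardCovarianceCT (β μ : ℝ) (K : TrigPolyC4v) (X Y : HubbardFieldIdx L M) :
    (fun X : HubbardFieldIdx L M => if X.2 = 0 then z X.1.2 else (z X.1.2)⁻¹) X * (fun X : HubbardFieldIdx L M => if X.2 = 0 then z X.1.2 else (z X.1.2)⁻¹) Y * hubbardCovarianceCT L M β μ 0 K X Y = hubbardCovarianceCT L M β μ 0 K X Y := by
  simp only [hubbardCovarianceCT, Matrix.of_apply, mul_neg, spinCharge_mul_hubbardTwoPointCT L M hz]

omit [NeZero L] in
/-- **The seedless CT covariance above scale `Λ` carries total weight one**: `c(X) c(Y) C^K_{>Λ}(X,Y) = C^K_{>Λ}(X,Y)` — the charge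
symmetry (2) of the Gaussian integration, spin by spin. [cite: BenfattoGiulianiMastropietro2006, §2.1 symmetry (2)] -/
theorem spinCharge_mul_hubbardCovAboveCT (β μ : ℝ) (K : TrigPolyC4v) (Λ : ℝ) (X Y : HubbardFieldIdx L M) :
    (fun X : HubbardFieldIdx L M => if X.2 = 0 then z X.1.2 else (z X.1.2)⁻¹) X * (fun X : HubbardFieldIdx L M => if X.2 = 0 then z X.1.2 else (z X.1.2)⁻¹) Y * hubbardCovAboveCT L M β μ 0 K Λ X Y = hubbardCovAboveCT L M β μ 0 K Λ X Y := by
  have h := spinCharge_mul_hubbardCovarianceCT L M hz β μ K X Y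
  simp only [hubbardCovAboveCT, Matrix.of_apply]
  conv_rhs => rw [← h]
  ring

/-- **The spin-resolved charge scaling is a symmetry of the seedless countertermed effective action**: `S_c 𝒢^K_Λ = 𝒢^K_Λ` at
`h = 0` for every frame, scale and all nonzero weights `z_↑, z_↓`. [cite: BenfattoGiulianiMastropietro2006, §2.1 symmetry (2)] -/
theorem map_spinCharge_hubbardEffectiveActionCT (β U μ : ℝ) (K : TrigPolyC4v) (Λ : ℝ) :
    (ExteriorAlgebra.map (LinearMap.mulLeft ℂ (fun X : HubbardFieldIdx L M => if X.2 = 0 then z X.1.2 else (z X.1.2)⁻¹))) (hubbardEffectiveActionCT L M β U μ 0 K Λ) = hubbardEffectiveActionCT L M β U μ 0 K Λ :=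
  map_mulLeft_effAction_of_invariant ℂ (spinCharge_inv_mul L M hz) (spinCharge_mul_hubbardCovAboveCT L M hz β μ K Λ)
    (map_spinCharge_hubbardInteractionCT L M hz β U K)

/-- **The kernels of the seedless countertermed effective action carry total spin-charge weight one**:
`(∏ᵢ c(Xᵢ)) · F_m(X) = F_m(X)` for all nonzero `z_↑, z_↓`. [cite: BenfattoGiulianiMastropietro2006, §2.1 symmetry (2)] -/
theorem prod_spinCharge_mul_kernel_hubbardEffectiveActionCT (β U μ : ℝ) (K : TrigPolyC4v) (Λ : ℝ) (m : ℕ)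
    (X : Fin m → HubbardFieldIdx L M) :
    (∏ i, (fun X : HubbardFieldIdx L M => if X.2 = 0 then z X.1.2 else (z X.1.2)⁻¹) (X i)) * kernel ℂ (hubbardEffectiveActionCT L M β U μ 0 K Λ) m X =
      kernel ℂ (hubbardEffectiveActionCT L M β U μ 0 K Λ) m X :=
  prod_mul_kernel_of_invariant ℂ (fun X : HubbardFieldIdx L M => if X.2 = 0 then z X.1.2 else (z X.1.2)⁻¹) (map_spinCharge_hubbardEffectiveActionCT L M hz β U μ K Λ) m X

end Fields

/-! ### The selection rule -/

section Selection

variable (L M : ℕ) [NeZero L]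

/-- `2^a · (2⁻¹)^b = 1` in `ℂ` forces `a = b`. [cite: BenfattoGiulianiMastropietro2006, §2.1 symmetry (2)] -/
theorem two_pow_mul_inv_two_pow_eq_one {a b : ℕ} (h : (2 : ℂ) ^ a * ((2 : ℂ)⁻¹) ^ b = 1) : a = b := by
  have h2 : ((2 : ℂ)⁻¹) ^ b * (2 : ℂ) ^ b = 1 := by rw [← mul_pow, inv_mul_cancel₀ two_ne_zero, one_pow]
  have h3 : (2 : ℂ) ^ a = (2 : ℂ) ^ b := by
    calc (2 : ℂ) ^ a = (2 : ℂ) ^ a * (((2 : ℂ)⁻¹) ^ b * (2 : ℂ) ^ b) := by rw [h2, mul_one]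
      _ = ((2 : ℂ) ^ a * ((2 : ℂ)⁻¹) ^ b) * (2 : ℂ) ^ b := by ring
      _ = (2 : ℂ) ^ b := by rw [h, one_mul]
  have h4 : ((2 ^ a : ℕ) : ℂ) = ((2 ^ b : ℕ) : ℂ) := by push_cast; exact h3
  exact Nat.pow_right_injective le_rfl (Nat.cast_injective h4)

/-- **Selection rule (BGM 2006 §2.1 symmetry (2), spin by spin)**: a kernel of the seedless countertermed effective action vanishes
on every label string in which, for some spin `σ`, the number of `ψ̂⁺_{·,σ}` legs differs from the number of `ψ̂⁻_{·,σ}` legs.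
[cite: BenfattoGiulianiMastropietro2006, §2.3] -/
theorem kernel_hubbardEffectiveActionCT_eq_zero_of_spinCharge (β U μ : ℝ) (K : TrigPolyC4v) (Λ : ℝ) {m : ℕ}
    (X : Fin m → HubbardFieldIdx L M) (s : Fin 2)
    (hne : (Finset.univ.filter fun i => (X i).1.2 = s ∧ (X i).2 = 0).card ≠
      (Finset.univ.filter fun i => (X i).1.2 = s ∧ (X i).2 = 1).card) :
    kernel ℂ (hubbardEffectiveActionCT L M β U μ 0 K Λ) m X = 0 := by
  -- the weight `z_s = 2`, `z_{s̄} = 1`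
  set z : Fin 2 → ℂ := fun t => if t = s then 2 else 1 with hz_def
  have hz : ∀ t, z t ≠ 0 := fun t => by by_cases h : t = s <;> simp [hz_def, h]
  have hinv := prod_spinCharge_mul_kernel_hubbardEffectiveActionCT L M hz β U μ K Λ m X
  -- the total weight is `2^a (2⁻¹)^b`
  have hprod : (∏ i, (fun X : HubbardFieldIdx L M => if X.2 = 0 then z X.1.2 else (z X.1.2)⁻¹) (X i)) =
      (2 : ℂ) ^ (Finset.univ.filter fun i => (X i).1.2 = s ∧ (X i).2 = 0).card *
        ((2 : ℂ)⁻¹) ^ (Finset.univ.filter fun i => (X i).1.2 = s ∧ (X i).2 = 1).card := by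
    have hterm : ∀ i, (fun X : HubbardFieldIdx L M => if X.2 = 0 then z X.1.2 else (z X.1.2)⁻¹) (X i) =
        (if (X i).1.2 = s ∧ (X i).2 = 0 then (2 : ℂ) else 1) * (if (X i).1.2 = s ∧ (X i).2 = 1 then (2 : ℂ)⁻¹ else 1) := by
      intro i
      have hc : (X i).2 = 0 ∨ (X i).2 = 1 := by
        rcases Fin.eq_zero_or_eq_succ (X i).2 with h | ⟨j, hj⟩
        · exact Or.inl h
        · right; rw [hj]; exact congrArg Fin.succ (Fin.eq_zero j)
      by_cases hs : (X i).1.2 = s <;> rcases hc with hc | hc <;> simp [hz_def, hs, hc]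
    simp_rw [hterm]
    rw [Finset.prod_mul_distrib, Finset.prod_ite, Finset.prod_ite]
    simp [Finset.prod_const]
  rw [hprod] at hinv
  have hw : (2 : ℂ) ^ (Finset.univ.filter fun i => (X i).1.2 = s ∧ (X i).2 = 0).card *
      ((2 : ℂ)⁻¹) ^ (Finset.univ.filter fun i => (X i).1.2 = s ∧ (X i).2 = 1).card ≠ 1 :=
    fun h => hne (two_pow_mul_inv_two_pow_eq_one h)
  have h' : ((2 : ℂ) ^ (Finset.univ.filter fun i => (X i).1.2 = s ∧ (X i).2 = 0).card *
      ((2 : ℂ)⁻¹) ^ (Finset.univ.filter fun i => (X i).1.2 = s ∧ (X i).2 = 1).card - 1) *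
      kernel ℂ (hubbardEffectiveActionCT L M β U μ 0 K Λ) m X = 0 := by
    rw [sub_mul, one_mul, hinv, sub_self]
  exact (mul_eq_zero.1 h').resolve_left (sub_ne_zero.2 hw)

end Selection

end Literature.MathematicalPhysics.QuantumLattice
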